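import Summits.QuantumFields.BalabanUV.T4Continuum.Spine.NE7.QLaBlockAvgContraction

/-!
# Spine/NE7/QLaBlockAvgPrintKind — NODE S's averaging-side certificates for the PRINTED (0.4) prescription `blockAvg expMeanLogSU`
# on `SU(N)` ON PRINT-KIND DOMAINS: sup-balls whose radius shrinks by the factor `L` per level (base `L`, as in
# [Balaban1985Averaging] (158)), not by `16ℓ = 32(d+1)·L` as in generation 8's `QLaBlockAvgContraction.dom`

Cell `pub-balaban-gaps` (YM blitz Y1, track G2, seat `ne7`, generation 14); text of record
`run/shared/lean/pub/pub-balaban-gaps/ne/NE7.md` (census row R61 and its successor row of this generation).  Fifty-first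
`Spine/NE7/` file; 0 sorry; [folklore] bookkeeping over generation 8's one-step estimates.

WHY.  Census R61 (v9.2) located a defect of KIND in generation 8's non-vacuity certificates for the headline's one-level printed
class: the sup-ball domains `QLaBlockAvgContraction.dom` have radius `ρ_j = ρ⋆·(16ℓ)^{−(m+K−j)}`, shrinking by `16ℓ = 32(d+1)L`
(`= 480 = 160·L` at `(d, L) = (4, 3)`) per level, whereas the printed small-field polydiscs [Balaban1985Averaging] (158)
`|A| < α₁`, `U = U₀e^{iηA}`, `η = L^{−n}`, have radius `∝ L^{−n}` — base `L`.  The extra factor `(32(d+1))^{−n}` came from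
bounding the framed one-step map's sup-deviation by the crude `dist1 F(V)(c) ≤ 16ℓρ` (`QLaBlockAvgOneStep.dist1_framed_le_sup`),
paid at every level.  But generation 8's own per-bond SECOND-ORDER estimate `dist1_framed_le`
(`dist1 F(V)(c) ≤ segMass(V,c) + 109ℓρ·remMass(V,c)`) already says more: to first order only the `L` transported bonds of the
straight segment move the framed coarse variable (`segMass ≤ L·ρ`), everything else is second order (`remMass ≤ 4ℓρ`), so
`dist1 F(V)(c) ≤ L·ρ + 436ℓ²·ρ²` (§1) — the linear growth factor is EXACTLY `L`, the base of (158).  A radius family growing by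
the factor `L` per level up to a quadratically small correction is then mapped into itself (§2, for ANY top value `2a` and any
quadratic coefficient `C` with `C·a ≤ ⅛`): `r_j(a) := a·(q^{e} + q^{2e})`, `q = 1∕L`, `e = m + K − j` satisfies
`L·r_j + C·r_j² ≤ r_{j+1}`; for `a = ρ⋆∕2`, `C = 436ℓ²` the condition is generation 8's `ρ⋆ ≤ θ∕(2K₁)`, `K₁ = 872dℓ²` (§3).
On these PRINT-KIND domains (`ρ_j ≥ (ρ⋆∕2)·L^{−(m+K−j)}`, top radius `ρ⋆` unchanged, `domPK ⊇ dom` at every level) the whole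
generation-8 tower goes through verbatim (§4–§5): `FlatStepContraction`, `BondDevBound`, `HolDevBound` (constant `e`, rate
`θ = L^{1−d}`), `LoopDefectBound` (constant `e²∕2`); generation 8's certificates are COROLLARIES by antitonicity in the domain (§6).
The sequel `QLaBlockAvgTwoLevelPrintKind` does the same for (0.10)–(0.12) over the generic §2 and states the headline-class forms.

WHAT THIS CHANGES IN THE CENSUS (words unchanged, R10): R61's clause «on PRINT-KIND domains NODE S's averaging-side input still
leans on ONE row-O3c item (a k-uniform bound of B7-Prop.-5 type for the COMPOSED (0.4) averaging)» is DISCHARGED for the one-level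
class in the flat-reference (one-point) form NODE S consumes: the k-uniformity is the smallness bootstrap of §2, not a composed-map
formula.  NOT claimed: the two-configuration NE1a-STEP of row O3c ([Balaban1985Averaging] Props 3–5), Bałaban's (52)∕(158)
conditions verbatim (ours are gauge-fixed sup-balls about the flat configuration), Bałaban's densities, `R`-operation or (1.100)
insert.  (QL-a) NOT IN PRINT; NE7 NOT proved; spine 0∕9; one fixed finite T⁴ — NOT ℝ⁴, NOT infinite volume, NOT a mass gap, NOT Clay.
-/

noncomputable section
open Finset
open scoped BigOperators Matrix Matrix.Norms.L2Operator

namespace Summit.QuantumFields.BalabanUV.T4Continuum.Spine.NE7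

open Literature.MathematicalPhysics.QuantumFieldTheory.Balaban1983to89
open Literature.MathematicalPhysics.QuantumFieldTheory.Balaban1983to89.T4Continuum
open Literature.MathematicalPhysics.QuantumFieldTheory.Balaban1983to89.T4AvgSensitivity
open Literature.MathematicalPhysics.QuantumFieldTheory.Balaban1983to89.T4AvgDerivBound
open Literature.MathematicalPhysics.QuantumFieldTheory.Balaban1983to89.BlockAveraging (Idx off blockAvg)
open ExpMeanLog

section SUN

variable {n : Type*} [Fintype n] [DecidableEq n] [Nonempty n]
variable {P : Params} {j : ℕ}

/-! ## §1 The sharp sup bound: the framed one-step map grows sup-deviations by the factor `L` to first order -/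

/-- **SHARP PER-BOND SUP BOUND FOR THE FRAMED ONE-STEP MAP** of the printed prescription [Balaban1987RG1] (0.4) on `SU(N)`: on
the sup-ball `dist1 V_b ≤ ρ` (`ℓρ < δ_N`, `ℓρ ≤ ½`), `dist1 F(V)(c) ≤ L·ρ + 436ℓ²·ρ²` — to first order only the `L` transported
bonds of the straight segment contribute (`segMass ≤ Lρ`, the main term (125) of [Balaban1985Averaging] Prop. 3 in kind), the rest
is second order (`remMass ≤ 4ℓρ`); generation 8's crude `dist1_framed_le_sup` gave `16ℓρ`. [folklore] -/
theorem dist1_framed_le_sharp (hj : j + 1 ≤ P.m + P.K) (V : GaugeField P j (Matrix.specialUnitaryGroup n ℂ)) {ρ : ℝ}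
    (hρ : 0 ≤ ρ) (hV : ∀ b, dist1 (V b) ≤ ρ) (hδ : ell P * ρ < deltaSU n) (h2 : ell P * ρ ≤ 1 / 2) (c : PBond P (j + 1)) :
    dist1 (framed V c) ≤ P.L * ρ + 436 * (ell P : ℝ) ^ 2 * ρ ^ 2 := by
  have hseg : segMass V c ≤ P.L * ρ := by
    refine meanR_le_of_le fun i => ?_
    refine (walkMass_le_length_mul V hV _).trans (le_of_eq ?_)
    rw [length_walk, List.length_replicate]
  have hs1 : stairMass V c.src ≤ ell P * ρ := meanR_le_of_le fun i => walkMass_stair_le V hρ hV _ i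
  have hs2 : loopMass V c ≤ ell P * ρ := meanR_le_of_le fun i => walkMass_loop_le V hρ hV c i
  have hs3 : axMass V c ≤ ell P * ρ := walkMass_ax_le V hρ hV _ _
  have hs4 : stairMass V c.tgt ≤ ell P * ρ := meanR_le_of_le fun i => walkMass_stair_le V hρ hV _ i
  have hrem : remMass V c ≤ 4 * (ell P * ρ) := by unfold remMass; linarith
  calc dist1 (framed V c) ≤ segMass V c + 109 * (ell P * ρ) * remMass V c := dist1_framed_le hj V hρ hV hδ h2 c
    _ ≤ P.L * ρ + 109 * (ell P * ρ) * (4 * (ell P * ρ)) := add_le_add hseg (mul_le_mul_of_nonneg_left hrem (by positivity))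
    _ = P.L * ρ + 436 * (ell P : ℝ) ^ 2 * ρ ^ 2 := by ring

/-! ## §2 Base-`L` radius families and the bootstrap step (generic: any top value `2a`, any quadratic coefficient `C` with `Ca ≤ ⅛`) -/

/-- THE BASE-`L` RADIUS FAMILY with top value `2a`: `r_j(a) = a·q^{e}(1 + q^{e})`, `q = 1∕L`, `e = m + K − j` — base `L` as the
polydiscs [Balaban1985Averaging] (158) `|A| < α₁` on the `η = L^{−n}` lattice; the factor `1 + q^{e}` is the slack that absorbs the
quadratic correction of a one-step map (`geomRad_step`). [cite: Balaban1985Averaging, (158) p.42] -/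
def geomRad (P : Params) (a : ℝ) (j : ℕ) : ℝ :=
  a * (((P.L : ℝ)⁻¹) ^ (P.m + P.K - j) * (1 + ((P.L : ℝ)⁻¹) ^ (P.m + P.K - j)))

/-- `0 < 1∕L ≤ ⅓` (`L` is odd and `> 1`, so `L ≥ 3`). [folklore] -/
theorem Linv_bounds (P : Params) : 0 < ((P.L : ℝ)⁻¹) ∧ (P.L : ℝ)⁻¹ ≤ 1 / 3 := by
  obtain ⟨⟨k, hk⟩, h1⟩ := P.hL
  have h3 : 3 ≤ P.L := by omega
  have hL0 : (0 : ℝ) < P.L := by have := P.L_pos; positivity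
  refine ⟨inv_pos.mpr hL0, ?_⟩
  rw [inv_le_comm₀ hL0 (by norm_num : (0 : ℝ) < 1 / 3)]
  norm_num; exact_mod_cast h3

/-- `θ = L^{1−d} ≤ 1`. [folklore] -/
theorem theta_le_one (P : Params) : theta P ≤ 1 := by
  have hL1 : (1 : ℝ) ≤ P.L := by exact_mod_cast P.L_pos
  have hpow : (P.L : ℝ) ≤ (P.L : ℝ) ^ P.d := le_self_pow₀ hL1 (by have := P.hd; omega)
  unfold theta
  rwa [← div_eq_mul_inv, div_le_one (by positivity)]

section Generic

variable (P : Params) {a : ℝ}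

/-- `0 ≤ r_j(a)` for `a ≥ 0`. [folklore] -/
theorem geomRad_nonneg (ha : 0 ≤ a) (j : ℕ) : 0 ≤ geomRad P a j := by
  obtain ⟨hq0, _⟩ := Linv_bounds P
  unfold geomRad; positivity

/-- `r_j(a) ≤ 2a·q^{m+K−j}` (the correction factor is at most `2`). [folklore] -/
theorem geomRad_le_geom (ha : 0 ≤ a) (j : ℕ) : geomRad P a j ≤ 2 * a * ((P.L : ℝ)⁻¹) ^ (P.m + P.K - j) := by
  obtain ⟨hq0, hq3⟩ := Linv_bounds P
  have hx0 : 0 ≤ ((P.L : ℝ)⁻¹) ^ (P.m + P.K - j) := pow_nonneg hq0.le _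
  have hx1 : ((P.L : ℝ)⁻¹) ^ (P.m + P.K - j) ≤ 1 := pow_le_one₀ hq0.le (by linarith)
  unfold geomRad
  nlinarith [mul_nonneg ha hx0, mul_le_mul_of_nonneg_left hx1 (mul_nonneg ha hx0)]

/-- `r_j(a) ≤ 2a`: the family never exceeds its top value. [folklore] -/
theorem geomRad_le_top (ha : 0 ≤ a) (j : ℕ) : geomRad P a j ≤ 2 * a := by
  obtain ⟨hq0, hq3⟩ := Linv_bounds P
  have hx1 : ((P.L : ℝ)⁻¹) ^ (P.m + P.K - j) ≤ 1 := pow_le_one₀ hq0.le (by linarith)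
  refine (geomRad_le_geom P ha j).trans ?_
  exact mul_le_of_le_one_right (by positivity) hx1

/-- **PRINT KIND**: `r_j(a) ≥ a·L^{−(m+K−j)}` — shrink factor `L` per level, base `L` as in [Balaban1985Averaging] (158), with the
LEVEL-INDEPENDENT constant `a`. [cite: Balaban1985Averaging, (158) p.42] -/
theorem base_le_geomRad (ha : 0 ≤ a) (j : ℕ) : a * ((P.L : ℝ)⁻¹) ^ (P.m + P.K - j) ≤ geomRad P a j := by
  obtain ⟨hq0, _⟩ := Linv_bounds P
  have hx0 : 0 ≤ ((P.L : ℝ)⁻¹) ^ (P.m + P.K - j) := pow_nonneg hq0.le _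
  unfold geomRad
  nlinarith [mul_nonneg ha hx0, mul_nonneg (mul_nonneg ha hx0) hx0]

/-- **A BASE-`L` FAMILY CONTAINS EVERY FASTER-SHRINKING GEOMETRIC FAMILY WITH THE SAME TOP**: `b·r^{−e} ≤ r_j(b∕2)` whenever
`r ≥ 2L` (generation 8's ratios `16ℓ` and `71|S_d|ℓ` both qualify). [folklore] -/
theorem geom_le_geomRad {b r : ℝ} (hb : 0 ≤ b) (hr : 2 * (P.L : ℝ) ≤ r) (j : ℕ) :
    b * (r⁻¹) ^ (P.m + P.K - j) ≤ geomRad P (b / 2) j := by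
  obtain ⟨hq0, hq3⟩ := Linv_bounds P
  have hL0 : (0 : ℝ) < 2 * P.L := by have := P.L_pos; positivity
  have hr0 : 0 < r := lt_of_lt_of_le hL0 hr
  rcases Nat.eq_zero_or_pos (P.m + P.K - j) with h0 | hpos
  · unfold geomRad
    rw [h0, pow_zero, pow_zero]
    linarith
  · refine le_trans ?_ (base_le_geomRad P (by positivity : 0 ≤ b / 2) j)
    have hinv : r⁻¹ ≤ (2 * P.L : ℝ)⁻¹ := by rw [inv_le_inv₀ hr0 hL0]; exact hr
    have hpow : (r⁻¹) ^ (P.m + P.K - j) ≤ ((2 * P.L : ℝ)⁻¹) ^ (P.m + P.K - j) :=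
      pow_le_pow_left₀ (inv_nonneg.mpr hr0.le) hinv _
    have hsplit : ((2 * P.L : ℝ)⁻¹) ^ (P.m + P.K - j) = ((2 : ℝ)⁻¹) ^ (P.m + P.K - j) * ((P.L : ℝ)⁻¹) ^ (P.m + P.K - j) := by
      rw [mul_inv, mul_pow]
    have hhalf : ((2 : ℝ)⁻¹) ^ (P.m + P.K - j) ≤ (2 : ℝ)⁻¹ := by
      obtain ⟨e, he⟩ : ∃ e, P.m + P.K - j = e + 1 := ⟨P.m + P.K - j - 1, by omega⟩
      rw [he, pow_succ]
      have : ((2 : ℝ)⁻¹) ^ e ≤ 1 := pow_le_one₀ (by norm_num) (by norm_num)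
      nlinarith
    have hx0 : 0 ≤ ((P.L : ℝ)⁻¹) ^ (P.m + P.K - j) := pow_nonneg hq0.le _
    calc b * (r⁻¹) ^ (P.m + P.K - j)
        ≤ b * (((2 : ℝ)⁻¹) ^ (P.m + P.K - j) * ((P.L : ℝ)⁻¹) ^ (P.m + P.K - j)) := by
          rw [← hsplit]; exact mul_le_mul_of_nonneg_left hpow hb
      _ ≤ b * ((2 : ℝ)⁻¹ * ((P.L : ℝ)⁻¹) ^ (P.m + P.K - j)) :=
          mul_le_mul_of_nonneg_left (mul_le_mul_of_nonneg_right hhalf hx0) hb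
      _ = b / 2 * ((P.L : ℝ)⁻¹) ^ (P.m + P.K - j) := by ring

/-- **THE BOOTSTRAP STEP**: `L·r_j + C·r_j² ≤ r_{j+1}` in the standing range, for every `a ≥ 0` and `C ≥ 0` with `C·a ≤ ⅛` — the
linear growth `L` is matched EXACTLY by the base-`L` radii (`L·q^{e'+1} = q^{e'}`), and the quadratic correction
`C·r_j² ≤ 4Ca·q²·a·q^{2e'}` fits in the slack `a·q^{2e'}(1 − q)` because `q ≤ ⅓`. [folklore] -/
theorem geomRad_step (ha : 0 ≤ a) {C : ℝ} (hC0 : 0 ≤ C) (hC : C * a ≤ 1 / 8) {j : ℕ} (hj : j + 1 ≤ P.m + P.K) :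
    (P.L : ℝ) * geomRad P a j + C * geomRad P a j ^ 2 ≤ geomRad P a (j + 1) := by
  obtain ⟨hq0, hq3⟩ := Linv_bounds P
  have hLq : (P.L : ℝ) * (P.L : ℝ)⁻¹ = 1 := mul_inv_cancel₀ (by have := P.L_pos; positivity)
  have he : P.m + P.K - j = (P.m + P.K - (j + 1)) + 1 := by omega
  set q : ℝ := (P.L : ℝ)⁻¹ with hq
  set e : ℕ := P.m + P.K - (j + 1) with he'
  have hx0 : 0 < q ^ e := pow_pos hq0 _
  have hx1 : q ^ e ≤ 1 := pow_le_one₀ hq0.le (by linarith)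
  have hj0 : geomRad P a j = a * (q * q ^ e * (1 + q * q ^ e)) := by
    simp only [geomRad, he, pow_succ, ← hq]
    ring
  have hj1 : geomRad P a (j + 1) = a * (q ^ e * (1 + q ^ e)) := by
    simp only [geomRad, ← he', ← hq]
  -- the linear part: `L·r_j = a·(x + q·x²)`, `x = q^e`
  have hlin : (P.L : ℝ) * geomRad P a j = a * (q ^ e + q * (q ^ e) ^ 2) := by
    rw [hj0]
    linear_combination (a * q ^ e * (1 + q * q ^ e)) * hLq
  -- the quadratic part: `r_j ≤ 2aq·x`
  have hr2 : geomRad P a j ≤ 2 * a * (q * q ^ e) := by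
    rw [hj0]
    have h1 : q * q ^ e ≤ 1 := by nlinarith
    have h2 : 0 ≤ a * (q * q ^ e) := by positivity
    nlinarith [mul_le_mul_of_nonneg_left h1 h2]
  have hsq : geomRad P a j ^ 2 ≤ (2 * a * (q * q ^ e)) ^ 2 := pow_le_pow_left₀ (geomRad_nonneg P ha j) hr2 2
  have hmain : q + 4 * (C * a) * q ^ 2 ≤ 1 := by
    nlinarith [mul_le_mul_of_nonneg_right hC (sq_nonneg q), sq_nonneg q]
  have hαx : 0 ≤ a * (q ^ e) ^ 2 := by positivity
  calc (P.L : ℝ) * geomRad P a j + C * geomRad P a j ^ 2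
      ≤ a * (q ^ e + q * (q ^ e) ^ 2) + C * (2 * a * (q * q ^ e)) ^ 2 :=
        add_le_add hlin.le (mul_le_mul_of_nonneg_left hsq hC0)
    _ = a * q ^ e + a * (q ^ e) ^ 2 * (q + 4 * (C * a) * q ^ 2) := by ring
    _ ≤ a * q ^ e + a * (q ^ e) ^ 2 * 1 := by gcongr
    _ = geomRad P a (j + 1) := by rw [hj1]; ring

/-- THE BASE-`L` RADII SUM TO AT MOST THE TOP VALUE `2a` along any stretch of levels in the standing range (a geometric tail with
ratio `q ≤ ⅓`, via generation 8's `geomTail_le`). [folklore] -/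
theorem sum_geomRad_le (ha : 0 ≤ a) {k n' : ℕ} (hkn : k + n' ≤ P.m + P.K) :
    ∑ i ∈ range n', geomRad P a (k + i) ≤ 2 * a := by
  obtain ⟨hq0, hq3⟩ := Linv_bounds P
  set q : ℝ := (P.L : ℝ)⁻¹ with hq
  have hq1 : q ≤ 1 := by linarith
  have hq2 : 2 * q ≤ 1 := by linarith
  have hsum : ∑ i ∈ range n', geomRad P a (k + i) ≤ 2 * a * ∑ i ∈ range n', q ^ ((P.m + P.K - k) - i) := by
    rw [Finset.mul_sum]
    refine Finset.sum_le_sum fun i _ => ?_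
    rw [Nat.sub_sub]
    exact geomRad_le_geom P ha (k + i)
  refine hsum.trans (mul_le_of_le_one_right (by positivity) ?_)
  refine (geomTail_le hq0.le hq2 (P.m + P.K - k) n' (by omega)).trans ?_
  calc 2 * q ^ (P.m + P.K - k - n' + 1) = (2 * q) * q ^ (P.m + P.K - k - n') := by ring
    _ ≤ 1 * 1 := mul_le_mul hq2 (pow_le_one₀ hq0.le hq1) (pow_nonneg hq0.le _) zero_le_one
    _ = 1 := by ring

end Generic

/-! ## §3 The print-kind radii and domains for the one-level prescription (0.4) -/

/-- THE PRINT-KIND RADIUS AT LEVEL `j` for (0.4): `ρ_j = r_j(ρ⋆∕2)` — base `L`, top radius `ρ⋆` (generation 8's `radStar`).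
[folklore] -/
def radPK (P : Params) (n : Type*) [Fintype n] (j : ℕ) : ℝ := geomRad P (radStar P n / 2) j

/-- THE PRINT-KIND DOMAIN FAMILY: sup-balls `dist1 V_b ≤ ρ_j` about the flat configuration with the print-kind radii. [folklore] -/
def domPK (P : Params) (n : Type*) [Fintype n] [DecidableEq n] [Nonempty n] (j : ℕ) :
    Set (GaugeField P j (Matrix.specialUnitaryGroup n ℂ)) :=
  {V | ∀ b, dist1 (V b) ≤ radPK P n j}

/-- `0 ≤ ρ⋆∕2`. [folklore] -/
theorem half_radStar_nonneg (P : Params) (n : Type*) [Fintype n] [Nonempty n] : 0 ≤ radStar P n / 2 :=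
  (half_pos (radStar_pos P n)).le
/-- `0 ≤ ρ_j`. [folklore] -/
theorem radPK_nonneg (P : Params) (n : Type*) [Fintype n] [Nonempty n] (j : ℕ) : 0 ≤ radPK P n j :=
  geomRad_nonneg P (half_radStar_nonneg P n) j

/-- `ρ_j ≤ ρ⋆`: the print-kind radii never exceed generation 8's top radius, so its guards hold. [folklore] -/
theorem radPK_le_radStar (P : Params) (n : Type*) [Fintype n] [Nonempty n] (j : ℕ) : radPK P n j ≤ radStar P n := by
  have := geomRad_le_top P (half_radStar_nonneg P n) j
  unfold radPK; linarith

/-- **PRINT KIND**: `ρ_j ≥ (ρ⋆∕2)·L^{−(m+K−j)}`. [cite: Balaban1985Averaging, (158) p.42] -/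
theorem printKind_le_radPK (P : Params) (n : Type*) [Fintype n] [Nonempty n] (j : ℕ) :
    radStar P n / 2 * ((P.L : ℝ)⁻¹) ^ (P.m + P.K - j) ≤ radPK P n j :=
  base_le_geomRad P (half_radStar_nonneg P n) j

/-- **THE PRINT-KIND DOMAINS CONTAIN GENERATION 8's**: `ρ⋆(16ℓ)^{−e} ≤ ρ_j` at every level (`16ℓ ≥ 2L`). [folklore] -/
theorem rad_le_radPK (P : Params) (n : Type*) [Fintype n] [Nonempty n] (j : ℕ) : rad P n j ≤ radPK P n j := by
  have hLℓ : 2 * (P.L : ℝ) ≤ 16 * ell P := by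
    have : (P.L : ℝ) ≤ ell P := by
      unfold ell; push_cast
      have hL0 : (0 : ℝ) ≤ P.L := Nat.cast_nonneg _
      have hd1 : (1 : ℝ) ≤ P.d := by exact_mod_cast P.hd
      nlinarith
    linarith
  exact geom_le_geomRad P (radStar_pos P n).le hLℓ j

/-- `dom_j ⊆ domPK_j`: every generation-8 domain configuration is a print-kind domain configuration. [folklore] -/
theorem dom_subset_domPK (j : ℕ) : dom P n j ⊆ domPK P n j := fun _ hV b => (hV b).trans (rad_le_radPK P n j)

/-- The guards on the print-kind domains: `ℓρ_j < δ_N` (the printed `log` of (0.4) is on its domain) and `ℓρ_j ≤ ½`. [folklore] -/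
theorem ell_mul_radPK (P : Params) (n : Type*) [Fintype n] [Nonempty n] (j : ℕ) :
    ell P * radPK P n j < deltaSU n ∧ ell P * radPK P n j ≤ 1 / 2 := by
  have hℓ := ell_pos P
  have hδ : 0 < deltaSU n := deltaSU_pos
  have hδ3 : deltaSU n ≤ 1 / 3 := min_le_left _ _
  have h1 : ell P * radPK P n j ≤ deltaSU n / 4 := by
    calc ell P * radPK P n j ≤ ell P * (deltaSU n / (4 * ell P)) :=
          mul_le_mul_of_nonneg_left ((radPK_le_radStar P n j).trans (min_le_left _ _)) hℓ.le
      _ = deltaSU n / 4 := by field_simp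
  exact ⟨by linarith, by linarith⟩

/-- The trivial configuration is in every print-kind domain. [folklore] -/
theorem one_mem_domPK (j : ℕ) : (1 : GaugeField P j (Matrix.specialUnitaryGroup n ℂ)) ∈ domPK P n j := fun b => by
  rw [show (1 : GaugeField P j (Matrix.specialUnitaryGroup n ℂ)) b = 1 from rfl, GaugeGroup.dist1_one]
  exact radPK_nonneg P n j

/-- `436ℓ²·(ρ⋆∕2) ≤ ⅛` — from generation 8's `ρ⋆ ≤ θ∕(2K₁)`, `K₁ = 872dℓ²`, `θ ≤ 1`, `d ≥ 1`. [folklore] -/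
theorem quadCoeff_small (P : Params) (n : Type*) [Fintype n] [Nonempty n] :
    436 * (ell P : ℝ) ^ 2 * (radStar P n / 2) ≤ 1 / 8 := by
  have hℓ := ell_pos P; have hθ := theta_le_one P; have hθ0 := theta_pos P
  have hd : (1 : ℝ) ≤ P.d := by exact_mod_cast P.hd
  have hK : radStar P n ≤ theta P / (2 * K1 P) := min_le_right _ _
  have hK' : 436 * (ell P : ℝ) ^ 2 * radStar P n ≤ 436 * (ell P : ℝ) ^ 2 * (theta P / (2 * K1 P)) :=
    mul_le_mul_of_nonneg_left hK (by positivity)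
  have he : 436 * (ell P : ℝ) ^ 2 * (theta P / (2 * K1 P)) = theta P / (4 * P.d) := by
    unfold K1
    field_simp
    ring
  have hq : theta P / (4 * P.d) ≤ 1 / 4 := by
    rw [div_le_iff₀ (by positivity)]
    nlinarith
  linarith

/-- **THE BOOTSTRAP STEP FOR (0.4)**: `L·ρ_j + 436ℓ²·ρ_j² ≤ ρ_{j+1}` in the standing range. [folklore] -/
theorem radPK_step (P : Params) (n : Type*) [Fintype n] [Nonempty n] {j : ℕ} (hj : j + 1 ≤ P.m + P.K) :
    (P.L : ℝ) * radPK P n j + 436 * (ell P : ℝ) ^ 2 * radPK P n j ^ 2 ≤ radPK P n (j + 1) :=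
  geomRad_step P (half_radStar_nonneg P n) (by positivity) (quadCoeff_small P n) hj

/-- THE PRINT-KIND RADII SUM TO AT MOST `ρ⋆` along any stretch of levels in the standing range. [folklore] -/
theorem sum_radPK_le (P : Params) (n : Type*) [Fintype n] [Nonempty n] {k n' : ℕ} (hkn : k + n' ≤ P.m + P.K) :
    ∑ i ∈ range n', radPK P n (k + i) ≤ radStar P n := by
  have := sum_geomRad_le P (half_radStar_nonneg P n) hkn
  unfold radPK; linarith

/-! ## §4 The tower on the print-kind domains -/

/-- **`FlatStepContraction` FOR THE PRINTED PRESCRIPTION ON `SU(N)` ON THE PRINT-KIND DOMAINS** with factors `θ + K₁ρ_j`: the frame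
is generation 8's `frameTransf`, the framed average stays in the next print-kind ball (§1 + `radPK_step`) and contracts total
variation from the flat configuration (`tv_framed_le`, unchanged). [folklore] -/
theorem flatStepContraction_blockAvgSU_printKind :
    FlatStepContraction (fun j => (blockAvg (expMeanLogSU (n := n)) : Averaging P j (Matrix.specialUnitaryGroup n ℂ))) (domPK P n)
      (fun j => theta P + K1 P * radPK P n j) := by
  intro j hj V hV
  obtain ⟨hδ, h2⟩ := ell_mul_radPK P n j
  refine ⟨frameTransf V, fun c => ?_, ?_⟩
  · show dist1 (framed V c) ≤ radPK P n (j + 1)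
    exact (dist1_framed_le_sharp hj V (radPK_nonneg P n j) hV hδ h2 c).trans (radPK_step P n hj)
  · show tv 1 (framed V) ≤ (theta P + K1 P * radPK P n j) * tv 1 V
    have := tv_framed_le hj V (radPK_nonneg P n j) hV hδ h2
    simpa only [K1, mul_assoc] using this

/-- **THE LEVEL FACTORS COMPOSE TO `e·θⁿ` ON THE PRINT-KIND DOMAINS** (`θ + K₁ρ ≤ θ·e^{K₁ρ/θ}`, `Σ_i K₁ρ_{k+i}/θ ≤ K₁ρ⋆/θ ≤ ½`).
[folklore] -/
theorem prod_factorPK_le (P : Params) (n : Type*) [Fintype n] [Nonempty n] {k n' : ℕ} (hkn : k + n' ≤ P.m + P.K) :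
    ∏ i ∈ range n', (theta P + K1 P * radPK P n (k + i)) ≤ Real.exp 1 * theta P ^ n' := by
  have hθ := theta_pos P
  have hK := K1_pos P
  have hfac : ∀ i ∈ range n', theta P + K1 P * radPK P n (k + i) ≤ theta P * Real.exp (K1 P / theta P * radPK P n (k + i)) := by
    intro i _
    have h1 := Real.add_one_le_exp (K1 P / theta P * radPK P n (k + i))
    have hθinv : theta P * (theta P)⁻¹ = 1 := mul_inv_cancel₀ hθ.ne'
    have e : theta P * (K1 P / theta P * radPK P n (k + i) + 1) = theta P + K1 P * radPK P n (k + i) := by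
      rw [div_eq_mul_inv]
      linear_combination (K1 P * radPK P n (k + i)) * hθinv
    calc theta P + K1 P * radPK P n (k + i) = theta P * (K1 P / theta P * radPK P n (k + i) + 1) := e.symm
      _ ≤ theta P * Real.exp (K1 P / theta P * radPK P n (k + i)) := mul_le_mul_of_nonneg_left h1 hθ.le
  have hpos : ∀ i ∈ range n', 0 ≤ theta P + K1 P * radPK P n (k + i) := fun i _ =>
    add_nonneg hθ.le (mul_nonneg hK.le (radPK_nonneg P n _))
  have hsum : ∑ i ∈ range n', K1 P / theta P * radPK P n (k + i) ≤ 1 := by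
    rw [← Finset.mul_sum]
    calc K1 P / theta P * ∑ i ∈ range n', radPK P n (k + i) ≤ K1 P / theta P * radStar P n :=
          mul_le_mul_of_nonneg_left (sum_radPK_le P n hkn) (by positivity)
      _ ≤ K1 P / theta P * (theta P / (2 * K1 P)) := mul_le_mul_of_nonneg_left (min_le_right _ _) (by positivity)
      _ = 1 / 2 := by
          rw [div_mul_div_comm, div_eq_iff (by positivity)]
          ring
      _ ≤ 1 := by norm_num
  calc ∏ i ∈ range n', (theta P + K1 P * radPK P n (k + i))
      ≤ ∏ i ∈ range n', theta P * Real.exp (K1 P / theta P * radPK P n (k + i)) := Finset.prod_le_prod hpos hfac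
    _ = theta P ^ n' * Real.exp (∑ i ∈ range n', K1 P / theta P * radPK P n (k + i)) := by
        rw [Finset.prod_mul_distrib, Finset.prod_const, Finset.card_range, Real.exp_sum]
    _ ≤ theta P ^ n' * Real.exp 1 := by gcongr
    _ = Real.exp 1 * theta P ^ n' := mul_comm _ _

/-! ## §5 `BondDevBound`, `HolDevBound`, `LoopDefectBound` on the print-kind domains -/

/-- **`BondDevBound (blockAvg expMeanLogSU) domPK e θ`, `θ = L^{1−d}`** — generation 4's per-coarse-bond shape for the printed
prescription [Balaban1987RG1] (0.4) on `SU(N)` ON THE PRINT-KIND DOMAINS. [folklore] -/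
theorem bondDevBound_blockAvgSU_printKind :
    BondDevBound (fun j => (blockAvg (expMeanLogSU (n := n)) : Averaging P j (Matrix.specialUnitaryGroup n ℂ))) (domPK P n)
      (Real.exp 1) (theta P) :=
  bondDevBound_of_flatStepContraction flatStepContraction_blockAvgSU_printKind
    (fun j => add_nonneg (theta_nonneg P) (mul_nonneg (K1_pos P).le (radPK_nonneg P n j)))
    fun _ _ hkn => prod_factorPK_le P n hkn

/-- **`HolDevBound (blockAvg expMeanLogSU) domPK e θ`** — NODE S's holonomy-level input (file 8) for the printed prescription on
`SU(N)` ON THE PRINT-KIND DOMAINS. [folklore] -/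
theorem holDevBound_blockAvgSU_printKind :
    HolDevBound (fun j => (blockAvg (expMeanLogSU (n := n)) : Averaging P j (Matrix.specialUnitaryGroup n ℂ))) (domPK P n)
      (Real.exp 1) (theta P) :=
  holDevBound_of_bondDevBound bondDevBound_blockAvgSU_printKind

/-- **`LoopDefectBound (blockAvg expMeanLogSU) domPK (e²/2) θ`** — generation 3's second-order loop-defect bound for the printed
prescription on `SU(N)` ON THE PRINT-KIND DOMAINS (criticality `reTrCrit_specialUnitaryGroup`). [folklore] -/
theorem loopDefectBound_blockAvgSU_printKind :
    LoopDefectBound (fun j => (blockAvg (expMeanLogSU (n := n)) : Averaging P j (Matrix.specialUnitaryGroup n ℂ))) (domPK P n)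
      (1 / 2 * Real.exp 1 ^ 2) (theta P) :=
  loopDefectBound_of_holDevBound reTrCrit_specialUnitaryGroup (by norm_num) holDevBound_blockAvgSU_printKind

/-! ## §6 Generation 8's certificates are corollaries (antitonicity in the domain) -/

/-- Generation 8's `holDevBound_blockAvgSU` (domains `dom`, base `16ℓ`) FOLLOWS from the print-kind certificate, since
`dom_j ⊆ domPK_j` (`HolDevBound.anti`). [folklore] -/
theorem holDevBound_blockAvgSU_of_printKind :
    HolDevBound (fun j => (blockAvg (expMeanLogSU (n := n)) : Averaging P j (Matrix.specialUnitaryGroup n ℂ))) (dom P n)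
      (Real.exp 1) (theta P) :=
  holDevBound_blockAvgSU_printKind.anti fun j => dom_subset_domPK j

end SUN

end Summit.QuantumFields.BalabanUV.T4Continuum.Spine.NE7

end
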